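import Summits.Ventures.CertifiedManyBodySolver.Theorems.M3x2EdgeSplitSymReplayGramRSyntax
import Summits.Ventures.CertifiedManyBodySolver.Theorems.M3x2EdgeSplitSymReplayDecode
import HarnessLib

/-!
# SymReplay gramR — the R DATA PATH: token-string decoder for orbit-representative Gram blocks
(pen hub-lb-sym-plan-1 g2, 2026-08-28; ADDITIVE module on the landed `…GramRSyntax` (p629331, this pen's text landed by
hub-lb-sym-eng-3) and `…Decode` (hub-lb-sym-eng-4) — nothing of either is touched; crit-1 V80 (B) / V83 additive + one-writer rules).

GRAMMAR (whitespace-separated integer tokens; `…Decode`'s `toks / rdNat / rdInt / rdQ / rdPolys / rdRows` reused by name):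
`gramR := n rblockⁿ` · `rblock := p q  nM moveⁿᴹ  nS polyⁿˢ  nR rowⁿᴿ` · `move := k vx vy cp cq` — `p q` = block scale,
`k` = index into `d4All = [r0, r1, r2, r3, sr0, sr1, sr2, sr3]` (`d4OfNat`), `(vx, vy)` = translation, `cp/cq` = character value,
`poly`/`row` exactly as in `…Decode`; `nR = nS`.  The converter ships TWO strings — the ordinary certificate text (grammar `…Decode`,
R-blocks removed from `gramM`) and the `gramR` text; checker input `decodeSymCertR (toks certS) (toks gramRS)`.
Reference emitter (python, exact arithmetic, verifies every representative identity): pub `hub-lb-sym-plan-1/gramr/gramR_emit.py`.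
First real block decoded + checked on the farm: `Cruxes/LowerEdge_ge_m83o100/ProbeC022_symplan1.lean` (v0core `mm.c0/22`, 15.9 s).

HONEST FRAMING: plumbing (a parser); no certificate is replayed here; no bound of record moves; no summit or crux statement is
proved here; nothing here predicts superconductivity.
-/

namespace Summit.Ventures.CertifiedManyBodySolver.Theorems.SymReplay

open Literature.Probability.LatticeModels

/-! ### TEXT DECODER for R-certificates (extends `…SymReplayDecode`, hub-lb-sym-eng-4, additively: its readers are
reused, nothing redefined).  An R-certificate ships as TWO token strings: the ordinary certificate text (decoded by
`decodeSymCert`, grammar in `…Decode`) and the `gramR` text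
`gramR: n rblockⁿ`, `rblock: p q  nM (k vx vy cp cq)ⁿᴹ  nS polyⁿˢ  nR rowⁿᴿ` — `p q` = scale, move `k` = index into
`d4All = [r0, r1, r2, r3, sr0, sr1, sr2, sr3]` (`d4R`: `r1 (x,y) = (−y,x)`, `sr0 (x,y) = (x,−y)`), `(vx vy)` = translation,
`cp cq` = character value, `poly`/`row` as in `…Decode` (`nS` representatives, `nR = nS` factor rows). -/
section DecodeR

/-- `D₄` element by index (order of `d4All`; junk `r0` past 7). -/
def d4OfNat : ℕ → DihedralGroup 4
  | 0 => .r 0 | 1 => .r 1 | 2 => .r 2 | 3 => .r 3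
  | 4 => .sr 0 | 5 => .sr 1 | 6 => .sr 2 | 7 => .sr 3
  | _ => .r 0

/-- Read `n` moves `(k vx vy cp cq)`. -/
def rdMoves : ℕ → Toks → List RMove × Toks
  | 0, ts => ([], ts)
  | n + 1, k :: x :: y :: p :: q :: ts => let r := rdMoves n ts; (⟨d4OfNat k.toNat, mkSite x y, (p : ℚ) / (q : ℚ)⟩ :: r.1, r.2)
  | _ + 1, _ => ([], [])

/-- Read an R-block `p q nM moveⁿᴹ nS polyⁿˢ nR rowⁿᴿ`. -/
def rdRBlock (ts : Toks) : GramBlockR × Toks :=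
  let s := rdQ ts
  let cm := rdNat s.2
  let m := rdMoves cm.1 cm.2
  let cb := rdNat m.2
  let b := rdPolys cb.1 cb.2
  let cr := rdNat b.2
  let r := rdRows cr.1 cr.2
  (⟨s.1, m.1, b.1, r.1⟩, r.2)

/-- Read `n` R-blocks. -/
def rdRBlocks : ℕ → Toks → List GramBlockR × Toks
  | 0, ts => ([], ts)
  | n + 1, ts => let b := rdRBlock ts; let r := rdRBlocks n b.2; (b.1 :: r.1, r.2)

/-- Decode a `gramR` text `n rblockⁿ`. -/
def decodeGramR (ts : Toks) : List GramBlockR := let c := rdNat ts; (rdRBlocks c.1 c.2).1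

/-- Tokens left over after a `gramR` text (a well-formed text leaves `0`). -/
def decodeGramRRest (ts : Toks) : ℕ := let c := rdNat ts; (rdRBlocks c.1 c.2).2.length

/-- **Decode an R-certificate** from the ordinary certificate text and the `gramR` text. -/
def decodeSymCertR (ts tsR : Toks) : SymCertR := { toSymCert := decodeSymCert ts, gramR := decodeGramR tsR }

/-- Kernel regression: the first R-block of `toyRCert` round-trips through the text grammar
(`1 32 · 8 moves · 1 rep (2 terms) · 1 row`), compared through the checker's own zero test. -/
example :
    (let B := (rdRBlock [1, 32, 8, 0, 0, 0, 1, 1, 1, 0, 0, 1, 1, 2, 0, 0, 1, 1, 3, 0, 0, 1, 1, 4, 0, 0, 1, 1, 5, 0, 0, 1, 1,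
        6, 0, 0, 1, 1, 7, 0, 0, 1, 1, 1, 2, 1, 1, 1, 0, 0, 0, 0, -1, 1, 1, 1, 0, 0, 0, 1, 1, 1, 0]).1
     let B₀ := (toyRCert.gramR[0]?).getD ⟨0, [], [], []⟩
     decide (B.scale = B₀.scale) && decide (B.moves.length = B₀.moves.length) &&
       ((B.reps.zip B₀.reps).all fun pq => isZero (psub pq.1 pq.2)) && decide (B.rows = B₀.rows) &&
       ((B.moves.zip B₀.moves).all fun mm => decide (mm.1.γ = mm.2.γ) && decide (mm.1.χ = mm.2.χ) &&
         decide (mm.1.v 0 = mm.2.v 0) && decide (mm.1.v 1 = mm.2.v 1))) = true := by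
  decide +kernel

end DecodeR

end Summit.Ventures.CertifiedManyBodySolver.Theorems.SymReplay
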